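import Literature.NumberTheory.EllipticCurves.BSDSelmerCMPConverseRankOneProofs
import Literature.NumberTheory.EllipticCurves.BSDSelmerCMPConverseProofs
import Literature.NumberTheory.EllipticCurves.BSDRankZeroDensityProofs
import Literature.NumberTheory.EllipticCurves.MordellWeilRankZeroProofs
import Literature.NumberTheory.EllipticCurves.LeadingTermPPartProofs
import Literature.NumberTheory.EllipticCurves.IwasawaLeadingTermProofs
import Literature.NumberTheory.EllipticCurves.BSDInvariantsProofs
import HarnessLib

/-!
# A trivial `p`-Selmer group in the tree's currencies: `#Sel^(p)(E/K) = 1 ⟹ rank E(K) = 0`,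
# `E(K)[p] = 0`, `Ш(E/K)[p^∞] = 0`, `#Sel_{p^∞}(E/K) = 1`, `corank_{ℤ_p} Sel_{p^∞}(E/K) = 0`;
# and transport along a change of Weierstrass equation

*Proofs* file (theorems only: no definition, no named fact, no instance; D-0014 / D-0026), all
FACT-FREE (standard axioms, no named-fact hypothesis). It formalises the first sentence of the
printed proof of

> M. Bhargava, C. Skinner, W. Zhang, *A majority of elliptic curves over `ℚ` satisfy the Birch and
> Swinnerton-Dyer conjecture*, arXiv:1407.1826v2 (2014), Theorem 5 (§2.1, p. 5), proof: "If the
> `p`-Selmer group `S_p(E)` of `E` is trivial, then so is the `p^∞`-Selmer group …, and hence the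
> Mordell–Weil group `E(ℚ)` is finite."

(Held-text locators, `paper:arxiv-1407.1826`, page-verified 2026-08-24 — ERRATUM E-G123-10,
docstring-only: Theorem 5 = `p0005` L10–L21, hypothesis (d) «the `p`-Selmer group `S_p(E)` of `E` is
trivial» = L19; the quoted first sentence of its proof = `p0005` L23; the sentence of the proof
of Theorem 9 used for `hWtors` below, «Since `E(ℚ)[p]` is trivial under (b)» = `p0005` L78.)

i.e. the passage from hypothesis (d) of that theorem ("the `p`-Selmer group `S_p(E)` of `E` is
trivial", in the tree `Nat.card (W.selmerGroup p) = 1`, the currency of the binder `h5` of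
`bsz_rankLeOne_cRank_of_pieces`) to the CORANK currency `W.selmerCorank p = 0` in which the tree
states its rank-zero `p`-converse theorems (`analyticRank_eq_zero_of_selmerCorank_eq_zero_of_mainConjecture`
and its siblings; Skinner 2016 Thm C, second clause), by the exact descent count
`#Sel^(p)(E/K) = p^{rank E(K)} · #E(K)[p] · #Ш(E/K)[p]` (Silverman, *AEC* X.4.2; tree
`natCard_selmerGroup_eq`):

* `rank_eq_zero_and_torsionBy_eq_bot_and_sha_inf_torsionBy_eq_bot_of_natCard_selmerGroup_eq_one`,
  `primaryComponent_sha_eq_bot_of_natCard_selmerGroup_eq_one`,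
  `shaCorank_eq_zero_of_natCard_selmerGroup_eq_one`,
  `natCard_selmerGroupPInfty_eq_one_of_natCard_selmerGroup_eq_one`,
  `selmerCorank_eq_zero_of_natCard_selmerGroup_eq_one_factFree` — for any elliptic curve over a number
  field `K` and any prime `p` (the Literature-side, number-field form of the cell tools
  `Summit.BirchSwinnertonDyer.Rank1Residual.X10.UnitRoad.natCard_selmerGroupPInfty_eq_one_of_natCard_selmerGroup_eq_one`
  and `Summit.BirchSwinnertonDyer.Rank1Residual.X10.RankZeroOfTrivialPSelmer.rank_zero_of_natCard_selmerGroup_eq_one`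
  (over `ℚ`, Summits-side, x10), which a `Literature/` file cannot import);
* `sha_inf_torsionBy_eq_bot_smul`, `selmerCorank_smul_eq_zero_of_natCard_selmerGroup_eq_one` —
  transport along an admissible change of variables `W ↝ C • W` (tree `galH1Equiv`,
  `mem_sha_iff_galH1Equiv_mem`, `mordellWeilRank_variableChange_holds`; Silverman X.§4: `Ш` and
  `Sel` are attached to `E/K`, not to an equation), needed wherever a converse theorem is stated
  on a global minimal model while the Selmer hypothesis is read on another model (`E_{A,B}`).

* `torsionBy_rat_eq_bot_of_hasIrreducibleModPGaloisRep`, `bsz_hWtors_five_of_irreducible` — the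
  companion statement `E(ℚ)[p] = 0` under (irr) (printed hypothesis (b); BSZ use it so in the proof
  of Thm 9), i.e. the binder `hWtors` of `bsz_rankLeOne_cRank_of_pieces` on `W ⊆ {E[5] irreducible}`.

Consumer: `LeadingTermBSZRankZeroLegProofs` (BSZ Thm 5 / the binder `h5`; BSD-DENSITY sprint, cell
`b2b-bsdres`). HONEST FRAMING: elementary bookkeeping; nothing is booked; no density number,
RESIDUAL-MAP mark, tier or status word moves by this file.

## References

* [BhargavaSkinnerZhang2014] M. Bhargava, C. Skinner, W. Zhang, arXiv:1407.1826v2, Thm. 5 (proof,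
  §2.1, p. 5).
* [SilvermanAEC2009] J. H. Silverman, *The Arithmetic of Elliptic Curves*, 2nd ed., GTM 106
  (2009), Thm. X.4.2; X.§4; VIII.6.7.
* [GreenbergLNM1716] R. Greenberg, LNM 1716 (1999), §1 p. 54.
-/

noncomputable section

open scoped Classical
open scoped AddSubgroup

open WeierstrassCurve

namespace Literature.NumberTheory.EllipticCurves

/-! ### Hypothesis (d) "`S_p(E)` trivial" in the tree's currencies (fact-free) -/

section Descent

variable {K : Type} [Field K] [NumberField K] (W : WeierstrassCurve K) [W.IsElliptic]
  (p : ℕ) [Fact p.Prime]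

/-- **`#Sel^(p)(E/K) = 1` forces `rank E(K) = 0`, `E(K)[p] = 0` and `Ш(E/K)[p] = 0`** (elliptic
curve over a number field, `p` prime): the exact descent count
`#Sel^(p)(E/K) = p^{rank E(K)} · #E(K)[p] · #(Ш(E/K) ⊓ H¹(K,E)[p])` (Silverman, *AEC* X.4.2(a),(b);
tree `natCard_selmerGroup_eq`) has all three factors equal to `1`. [cite: SilvermanAEC2009, Thm X.4.2] -/
theorem rank_eq_zero_and_torsionBy_eq_bot_and_sha_inf_torsionBy_eq_bot_of_natCard_selmerGroup_eq_one
    (h : Nat.card (W.selmerGroup p) = 1) :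
    W.mordellWeilRank = 0 ∧ W.toAffine.Point[(p : ℤ)] = ⊥ ∧
      (W.sha ⊓ AddSubgroup.torsionBy W.galH1 (p : ℤ) : AddSubgroup W.galH1) = ⊥ := by
  have hp : p.Prime := Fact.out
  have hcard := W.natCard_selmerGroup_eq hp.ne_zero
  rw [h] at hcard
  have h12 := Nat.eq_one_of_mul_eq_one_right hcard.symm
  have h3 := Nat.eq_one_of_mul_eq_one_left hcard.symm
  have h1 := Nat.eq_one_of_mul_eq_one_right h12
  have h2 := Nat.eq_one_of_mul_eq_one_left h12
  refine ⟨?_, AddSubgroup.eq_bot_of_card_eq _ h2, AddSubgroup.eq_bot_of_card_eq _ h3⟩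
  rcases Nat.pow_eq_one.mp h1 with h | h
  · exact absurd h hp.one_lt.ne'
  · exact h

/-- **`#Sel^(p)(E/K) = 1 ⟹ Ш(E/K)[p^∞] = 0`**: no `p`-torsion in `Ш` means no `p`-primary part
(tree `primaryComponent_sha_eq_bot_of_inf_torsionBy_eq_bot`). [cite: SilvermanAEC2009, Thm X.4.2] -/
theorem primaryComponent_sha_eq_bot_of_natCard_selmerGroup_eq_one
    (h : Nat.card (W.selmerGroup p) = 1) : AddCommGroup.primaryComponent W.sha p = ⊥ :=
  primaryComponent_sha_eq_bot_of_inf_torsionBy_eq_bot W p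
    (rank_eq_zero_and_torsionBy_eq_bot_and_sha_inf_torsionBy_eq_bot_of_natCard_selmerGroup_eq_one
      W p h).2.2

/-- **`#Sel^(p)(E/K) = 1 ⟹ corank_{ℤ_p} Ш(E/K)[p^∞] = 0`** (indeed `Ш[p^∞] = 0`).
[cite: SilvermanAEC2009, Thm X.4.2] -/
theorem shaCorank_eq_zero_of_natCard_selmerGroup_eq_one (h : Nat.card (W.selmerGroup p) = 1) :
    W.shaCorank p = 0 := by
  have hbot := primaryComponent_sha_eq_bot_of_natCard_selmerGroup_eq_one W p h
  have hfin : Finite (AddCommGroup.primaryComponent W.sha p) := by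
    rw [hbot]; infer_instance
  exact (finite_primaryComponent_sha_iff_shaCorank_eq_zero W p).1 hfin

/-- **`#Sel^(p)(E/K) = 1 ⟹ #Sel_{p^∞}(E/K) = 1`** — the first sentence of the printed proof of
BSZ Thm 5 ("If the `p`-Selmer group `S_p(E)` of `E` is trivial, then so is the `p^∞`-Selmer group
…, and hence the Mordell–Weil group `E(ℚ)` is finite", arXiv p. 5): in rank `0` (so `E(K)`
finite, Silverman VIII.6.7) `#Sel_{p^∞}(E/K) = #Ш(E/K)[p^∞]` (Greenberg, LNM 1716, §1 p. 54; tree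
`natCard_selmerGroupPInfty_eq_natCard_primaryComponent_sha`), and `Ш[p^∞] = 0`.
[cite: BhargavaSkinnerZhang2014, Thm. 5 (proof, §2.1, p. 5)] [cite: SilvermanAEC2009, Thm X.4.2]
[cite: GreenbergLNM1716, §1 p. 54] -/
theorem natCard_selmerGroupPInfty_eq_one_of_natCard_selmerGroup_eq_one
    (h : Nat.card (W.selmerGroup p) = 1) : Nat.card (W.selmerGroupPInfty p) = 1 := by
  have hr :=
    (rank_eq_zero_and_torsionBy_eq_bot_and_sha_inf_torsionBy_eq_bot_of_natCard_selmerGroup_eq_one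
      W p h).1
  haveI : Finite W.toAffine.Point := W.mordellWeilRank_eq_zero_iff_finite.mp hr
  rw [W.natCard_selmerGroupPInfty_eq_natCard_primaryComponent_sha p,
    primaryComponent_sha_eq_bot_of_natCard_selmerGroup_eq_one W p h, AddSubgroup.card_bot]

/-- **Hypothesis (d) in corank currency: `#Sel^(p)(E/K) = 1 ⟹ corank_{ℤ_p} Sel_{p^∞}(E/K) = 0`**
(RENAMED 2026-08-23 from `selmerCorank_eq_zero_of_natCard_selmerGroup_eq_one`: that name was landed in
the same gate batch by `SelmerCardinalityPConverses.lean` for the Cassels–Tate version of the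
statement — a duplicate fully-qualified name no module could co-import; this FACT-FREE version
takes the suffix `_factFree`, the cell lead's name stands.)
(`Sel_{p^∞}(E/K)` is trivial, in particular finite; tree
`finite_selmerGroupPInfty_iff_selmerCorank_eq_zero`). This is the step from BSZ Thm 5's printed
hypothesis "the `p`-Selmer group `S_p(E)` of `E` is trivial" to the hypothesis
`corank Sel_{p^∞} = 0` of the rank-zero `p`-converses in the tree. [cite: BhargavaSkinnerZhang2014, Thm. 5 (d)]
[cite: SilvermanAEC2009, Thm X.4.2] -/
theorem selmerCorank_eq_zero_of_natCard_selmerGroup_eq_one_factFree (h : Nat.card (W.selmerGroup p) = 1) :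
    W.selmerCorank p = 0 := by
  have h1 := natCard_selmerGroupPInfty_eq_one_of_natCard_selmerGroup_eq_one W p h
  haveI : Finite (W.selmerGroupPInfty p) := Nat.finite_of_card_ne_zero (by omega)
  exact (finite_selmerGroupPInfty_iff_selmerCorank_eq_zero W p).1 ‹_›

end Descent

/-! ### Transport along an admissible change of variables (fact-free) -/

section Transport

variable {K : Type} [Field K] [NumberField K] (W : WeierstrassCurve K) (C : VariableChange K)

/-- **`Ш(W/K)[n] = 0 ⟹ Ш(C • W/K)[n] = 0`** for an admissible change of variables `C`: `Ш` is
attached to `E/K`, not to a Weierstrass equation (Silverman, *AEC* X.§4) — the tree's additive,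
`Γ_K`-equivariant `galH1Equiv : H¹(K, W) ≃+ H¹(K, C • W)` identifies the two Tate–Shafarevich
groups (`mem_sha_iff_galH1Equiv_mem`) and commutes with multiplication by `n`.
[cite: SilvermanAEC2009, X.§4] -/
theorem sha_inf_torsionBy_eq_bot_smul (n : ℕ)
    (h : (W.sha ⊓ AddSubgroup.torsionBy W.galH1 n : AddSubgroup W.galH1) = ⊥) :
    ((C • W).sha ⊓ AddSubgroup.torsionBy (C • W).galH1 n : AddSubgroup (C • W).galH1) = ⊥ := by
  rw [eq_bot_iff]
  intro c hc
  obtain ⟨hsha, htor⟩ := AddSubgroup.mem_inf.mp hc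
  have hc' : (galH1Equiv W C).symm c ∈
      (W.sha ⊓ AddSubgroup.torsionBy W.galH1 n : AddSubgroup W.galH1) := by
    refine AddSubgroup.mem_inf.mpr ⟨?_, ?_⟩
    · rw [mem_sha_iff_galH1Equiv_mem W C, AddEquiv.apply_symm_apply]
      exact hsha
    · have hn := AddSubgroup.torsionBy.nsmul_iff.mp htor
      refine AddSubgroup.torsionBy.nsmul_iff.mpr ?_
      rw [← map_nsmul, hn, map_zero]
  rw [h, AddSubgroup.mem_bot, AddEquiv.symm_apply_eq, map_zero] at hc'
  rw [AddSubgroup.mem_bot, hc']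

variable [W.IsElliptic]

/-- **`#Sel^(p)(W/K) = 1 ⟹ corank_{ℤ_p} Sel_{p^∞}(C • W/K) = 0`** for an admissible change of
variables `C`: rank and `Ш[p]` are isomorphism invariants (`mordellWeilRank_variableChange_holds`,
`sha_inf_torsionBy_eq_bot_smul`), and `corank Sel_{p^∞} = rank + corank Ш[p^∞]`
(`selmerCorank_eq_mordellWeilRank_add_holds`, Greenberg LNM 1716 §1). Used to move hypothesis (d)
of BSZ Thm 5 from an arbitrary model (`E_{A,B}`) to a global minimal one.
[cite: SilvermanAEC2009, X.§4] [cite: GreenbergLNM1716, §1 p. 54] -/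
theorem selmerCorank_smul_eq_zero_of_natCard_selmerGroup_eq_one (p : ℕ) [Fact p.Prime]
    (h : Nat.card (W.selmerGroup p) = 1) : (C • W).selmerCorank p = 0 := by
  obtain ⟨hr, -, hsha⟩ :=
    rank_eq_zero_and_torsionBy_eq_bot_and_sha_inf_torsionBy_eq_bot_of_natCard_selmerGroup_eq_one
      W p h
  have hr' : (C • W).mordellWeilRank = 0 := by
    have hCW : (C • W).mordellWeilRank = W.mordellWeilRank := mordellWeilRank_variableChange_holds W C
    rw [hCW, hr]
  have hsha' := sha_inf_torsionBy_eq_bot_smul W C p hsha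
  have hprim := primaryComponent_sha_eq_bot_of_inf_torsionBy_eq_bot (C • W) p hsha'
  have hfin : Finite (AddCommGroup.primaryComponent (C • W).sha p) := by
    rw [hprim]; infer_instance
  rw [(C • W).selmerCorank_eq_mordellWeilRank_add_holds p, hr', zero_add]
  exact (finite_primaryComponent_sha_iff_shaCorank_eq_zero (C • W) p).1 hfin

end Transport

/-! ### The companion binder `hWtors` under (irr) (printed (b)) -/

section Torsion

/-- **No rational `p`-torsion under (irr)**: for an elliptic `W/ℚ` with `E[p]` irreducible,
`E(ℚ)[p] = 0` (a rational point of order `p` spans a `Γ_ℚ`-stable line; tree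
`natCard_torsionBy_eq_one_of_hasIrreducibleModPGaloisRep`, Mazur 1977 p. 157). This is how BSZ use
hypothesis (b) in the proof of Thm 9 ("Since `E(ℚ)[p]` is trivial under (b)", arXiv p. 5) and how
the binder `hWtors` of `bsz_rankLeOne_cRank_of_pieces` is met on `W ⊆ {E[5] irreducible}`.
[cite: BhargavaSkinnerZhang2014, proof of Thm. 9 (§2.2, p. 5)] [cite: Mazur1977, Ch. III §5, p. 157] -/
theorem torsionBy_rat_eq_bot_of_hasIrreducibleModPGaloisRep (W : WeierstrassCurve ℚ) [W.IsElliptic]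
    (p : ℕ) [Fact p.Prime] (hirr : W.HasIrreducibleModPGaloisRep p) :
    W.toAffine.Point[(p : ℤ)] = ⊥ :=
  AddSubgroup.eq_bot_of_card_eq _ (natCard_torsionBy_eq_one_of_hasIrreducibleModPGaloisRep W p hirr)

/-- **The binder `hWtors` of `bsz_rankLeOne_cRank_of_pieces` in its own currency, from (irr) at
`5`**: for `(A, B)` in the height family with `E_{A,B}[5]` irreducible, `E_{A,B}(ℚ)[5] = 0`.
[cite: BhargavaSkinnerZhang2014, proof of Thm. 9 (§2.2, p. 5)] -/
theorem bsz_hWtors_five_of_irreducible {AB : ℤ × ℤ} (hfam : IsInHeightFamily AB)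
    (hirr : (shortWeierstrass AB).HasIrreducibleModPGaloisRep 5) :
    (shortWeierstrass AB).toAffine.Point[(5 : ℤ)] = ⊥ := by
  haveI := isElliptic_shortWeierstrass hfam
  haveI : Fact (Nat.Prime 5) := ⟨Nat.prime_five⟩
  have h := torsionBy_rat_eq_bot_of_hasIrreducibleModPGaloisRep (shortWeierstrass AB) 5 hirr
  exact_mod_cast h

end Torsion

end Literature.NumberTheory.EllipticCurves

end
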